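import Literature.Geometry.DiscreteGeometry.SphericalPolygonArea
import Literature.Geometry.DiscreteGeometry.ConeTiling
import HarnessLib

/-!
# The fan triangulation of a convex polygonal cone: the triangles from a vertex lie inside the
# cone and overlap in null sets, so their solid angles add up to at most that of the cone

Topic `Literature/Geometry/DiscreteGeometry`; a small brick of the face theory of spherical
subdivisions (`SphericalPolygonArea.lean`: the convex polygonal cone `polyCone n w` of edge rays
`w 0, …, w (n−1)` with all cyclically ordered triples positively oriented, and Girard for
polygons; `ConeTiling.lean`: additivity of ball fractions).  To ESTIMATE the area of a facet of
the hull of a spherical code from estimates for TRIANGLES (Hales 2012, proof of Theorem 2: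
"Triangles correspond to triangulated faces of the polyhedron obtained as the convex hull …
`U_F`, up to a set of measure zero, is a disjoint union of cones over Delaunay triangles … We may
calculate the solid angle of `U_F` … by this triangulation"), one triangulates the polygon by
the diagonals from its first vertex.  This file proves what that needs:

* `fanCone w i = apexCone 0 ![w 0, w (i+1), w (i+2)]`, the cone over the `i`-th fan triangle;
  `fanCone_subset_polyCone` (each fan triangle lies in the polygon),
  `fanCone_inter_fanCone_subset` / `volume_fanCone_inter_fanCone` (two fan triangles overlap
  inside the plane through `w 0, w (i+2)`, a null set);
* **`sum_solidAngleFraction_fan_le`**: `Σ_{i < n−2} sol(w 0, w (i+1), w (i+2))/4π ≤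
  vol-fraction of polyCone n w` — the solid angles of the fan triangles add up to at most the
  solid angle of the polygonal cone (in fact to exactly it; only the inequality, which avoids
  the converse inclusion, is recorded here).

Everything is PROVED; no named facts.

## References
* T. C. Hales, arXiv:1209.6043 (2012), proof of Theorem 2 (triangulation of `U_F`). [`Hales2012`]
* A.-M. Legendre, *Éléments de géométrie* (1794), VII (decomposition of spherical polygons into
  triangles). [folklore]
-/

noncomputable section

namespace Literature.Geometry.DiscreteGeometry

open Real RealInnerProductSpace MeasureTheory Metric Set Finset

section Fan

local notation "E3" => EuclideanSpace ℝ (Fin 3)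

/-- **The cone over the `i`-th fan triangle** `(w 0, w (i+1), w (i+2))` of the polygon
`w 0, …, w (n−1)`. [folklore] -/
def fanCone (w : ℕ → E3) (i : ℕ) : Set E3 := apexCone (0 : E3) ![w 0, w (i + 1), w (i + 2)]

/-- Unfolding `fanCone`. [folklore] -/
theorem fanCone_def (w : ℕ → E3) (i : ℕ) :
    fanCone w i = apexCone (0 : E3) ![w 0, w (i + 1), w (i + 2)] := rfl

/-- A point of a fan cone is a nonnegative combination of its three edge rays. [folklore] -/
theorem exists_of_mem_fanCone {w : ℕ → E3} {i : ℕ} {x : E3} (hx : x ∈ fanCone w i) :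
    ∃ α β γ : ℝ, 0 ≤ α ∧ 0 ≤ β ∧ 0 ≤ γ ∧ x = α • w 0 + β • w (i + 1) + γ • w (i + 2) := by
  obtain ⟨c, hc, rfl⟩ := hx
  refine ⟨c 0, c 1, c 2, hc 0, hc 1, hc 2, ?_⟩
  simp [Fin.sum_univ_three]

/-- The fan cone in determinant (facet) form, for a positively oriented triangle. [folklore] -/
theorem fanCone_eq_inter₃ {w : ℕ → E3} {i : ℕ} (h : 0 < orient3 (w 0) (w (i + 1)) (w (i + 2))) :
    fanCone w i = {x : E3 | 0 ≤ orient3 (w (i + 1)) (w (i + 2)) x} ∩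
      {x | 0 ≤ orient3 (w (i + 2)) (w 0) x} ∩ {x | 0 ≤ orient3 (w 0) (w (i + 1)) x} := by
  rw [fanCone, ← setOf_orient3_inter₃_eq_apexCone h]

/-- Fan cones are measurable (closed). [folklore] -/
theorem measurableSet_fanCone {w : ℕ → E3} {i : ℕ}
    (h : 0 < orient3 (w 0) (w (i + 1)) (w (i + 2))) : MeasurableSet (fanCone w i) := by
  rw [fanCone_eq_inter₃ h]
  exact ((measurableSet_orient3_nonneg _ _).inter (measurableSet_orient3_nonneg _ _)).inter
    (measurableSet_orient3_nonneg _ _)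

/-- The ball fraction of a fan cone is the solid-angle fraction of its triangle. [folklore] -/
theorem ballFraction_fanCone (w : ℕ → E3) (i : ℕ) :
    ballFraction (0 : E3) (fanCone w i) = solidAngleFraction 0 ![w 0, w (i + 1), w (i + 2)] := rfl

variable {n : ℕ} {w : ℕ → E3}

/-- In a convex polygonal cone every facet functional `det[w a; w (a+1 mod n); ·]` is
nonnegative at every edge ray `w j`. [folklore] -/
theorem orient3_consec_vertex_nonneg (hn : 3 ≤ n)
    (hw : ∀ i j k, i < j → j < k → k < n → 0 < orient3 (w i) (w j) (w k)) {a j : ℕ}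
    (ha : a < n) (hj : j < n) : 0 ≤ orient3 (w a) (w ((a + 1) % n)) (w j) := by
  rcases Nat.lt_or_ge (a + 1) n with ha1 | ha1
  · rw [Nat.mod_eq_of_lt ha1]
    rcases Nat.lt_trichotomy j a with hja | rfl | hja
    · rw [← orient3_cyclic]; exact (hw j a (a + 1) hja (by omega) ha1).le
    · simp
    · rcases Nat.lt_or_ge j (a + 2) with hj' | hj'
      · obtain rfl : j = a + 1 := by omega
        simp
      · exact (hw a (a + 1) j (by omega) (by omega) hj).le
  · obtain rfl : a = n - 1 := by omega
    rw [show n - 1 + 1 = n by omega, Nat.mod_self]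
    rcases Nat.eq_zero_or_pos j with rfl | hj0
    · simp
    · rcases Nat.lt_or_ge j (n - 1) with hj' | hj'
      · rw [orient3_cyclic]; exact (hw 0 j (n - 1) hj0 hj' (by omega)).le
      · obtain rfl : j = n - 1 := by omega
        simp

/-- **Each fan triangle lies in the polygonal cone.** [folklore] -/
theorem fanCone_subset_polyCone (hn : 3 ≤ n)
    (hw : ∀ i j k, i < j → j < k → k < n → 0 < orient3 (w i) (w j) (w k)) {i : ℕ}
    (hi : i + 2 < n) : fanCone w i ⊆ polyCone n w := by
  intro x hx a ha
  obtain ⟨α, β, γ, hα, hβ, hγ, rfl⟩ := exists_of_mem_fanCone hx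
  simp only [orient3_add_right, orient3_smul_right]
  exact add_nonneg (add_nonneg (mul_nonneg hα (orient3_consec_vertex_nonneg hn hw ha (by omega)))
    (mul_nonneg hβ (orient3_consec_vertex_nonneg hn hw ha (by omega))))
    (mul_nonneg hγ (orient3_consec_vertex_nonneg hn hw ha hi))

/-- **Two fan triangles `i < j` overlap only inside the plane through `w 0, w (i+2)`.**
[folklore] -/
theorem fanCone_inter_fanCone_subset
    (hw : ∀ i j k, i < j → j < k → k < n → 0 < orient3 (w i) (w j) (w k)) {i j : ℕ}
    (hij : i < j) (hj : j + 2 < n) :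
    fanCone w i ∩ fanCone w j ⊆ {x | orient3 (w 0) (w (i + 2)) x = 0} := by
  intro x hx
  have hpi : 0 < orient3 (w 0) (w (i + 1)) (w (i + 2)) := hw 0 (i + 1) (i + 2) (by omega)
    (by omega) (by omega)
  -- from `x ∈ fanCone w i`: `det[w 0; w (i+2); x] ≤ 0`
  have h1 : orient3 (w 0) (w (i + 2)) x ≤ 0 := by
    have hx1 := hx.1
    rw [fanCone_eq_inter₃ hpi] at hx1
    have h12 : 0 ≤ orient3 (w (i + 2)) (w 0) x := hx1.1.2
    rw [orient3_swap_left] at h12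
    linarith
  -- from `x ∈ fanCone w j`: `det[w 0; w (i+2); x] ≥ 0`
  have h2 : 0 ≤ orient3 (w 0) (w (i + 2)) x := by
    obtain ⟨α, β, γ, hα, hβ, hγ, hxe⟩ := exists_of_mem_fanCone hx.2
    rw [hxe]
    simp only [orient3_add_right, orient3_smul_right, orient3_self_outer, mul_zero, zero_add]
    refine add_nonneg (mul_nonneg hβ ?_) (mul_nonneg hγ ?_)
    · rcases Nat.lt_or_ge (i + 2) (j + 1) with h | h
      · exact (hw 0 (i + 2) (j + 1) (by omega) h (by omega)).le
      · obtain h' : j + 1 = i + 2 := by omega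
        rw [h']; simp
    · exact (hw 0 (i + 2) (j + 2) (by omega) (by omega) hj).le
  exact le_antisymm h1 h2

/-- Hence two distinct fan triangles overlap in a null set. [folklore] -/
theorem volume_fanCone_inter_fanCone
    (hw : ∀ i j k, i < j → j < k → k < n → 0 < orient3 (w i) (w j) (w k)) {i j : ℕ}
    (hij : i < j) (hj : j + 2 < n) : volume (fanCone w i ∩ fanCone w j) = 0 := by
  refine measure_mono_null (fanCone_inter_fanCone_subset hw hij hj) ?_
  exact volume_orient3_eq_zero (c := w (i + 3))
    (hw 0 (i + 2) (i + 3) (by omega) (by omega) (by omega)).ne'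

/-- Ball fractions are monotone in the set. [folklore] -/
theorem ballFraction_mono (v : E3) {S T : Set E3} (h : S ⊆ T) :
    ballFraction v S ≤ ballFraction v T := by
  unfold ballFraction
  refine div_le_div_of_nonneg_right ?_ ENNReal.toReal_nonneg
  exact ENNReal.toReal_mono (measure_lt_top_of_subset inter_subset_left measure_ball_lt_top.ne).ne
    (measure_mono (inter_subset_inter_right _ h))

/-- **The solid angles of the fan triangles of a convex polygonal cone add up to at most the
solid angle of the cone**: for `w 0, …, w (n−1)` (`n ≥ 3`) with all cyclically ordered triples
positively oriented,
`Σ_{i < n−2} solidAngleFraction 0 (w 0, w (i+1), w (i+2)) ≤ ballFraction 0 (polyCone n w)`.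
(Equality holds — the fan triangles tile the polygon — but is not needed for lower bounds.)
[folklore] -/
theorem sum_solidAngleFraction_fan_le (hn : 3 ≤ n)
    (hw : ∀ i j k, i < j → j < k → k < n → 0 < orient3 (w i) (w j) (w k)) :
    ∑ i ∈ range (n - 2), solidAngleFraction 0 ![w 0, w (i + 1), w (i + 2)] ≤
      ballFraction (0 : E3) (polyCone n w) := by
  have hpos : ∀ i, i + 2 < n → 0 < orient3 (w 0) (w (i + 1)) (w (i + 2)) := fun i hi =>
    hw 0 (i + 1) (i + 2) (by omega) (by omega) hi
  have hmeas : ∀ i ∈ range (n - 2), MeasurableSet (fanCone w i) := fun i hi =>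
    measurableSet_fanCone (hpos i (by have := mem_range.1 hi; omega))
  have hnull : ((range (n - 2) : Finset ℕ) : Set ℕ).Pairwise
      fun i j => volume (fanCone w i ∩ fanCone w j) = 0 := by
    intro i hi j hj hij
    have hi' := mem_range.1 (Finset.mem_coe.1 hi)
    have hj' := mem_range.1 (Finset.mem_coe.1 hj)
    rcases Nat.lt_or_gt_of_ne hij with h | h
    · exact volume_fanCone_inter_fanCone hw h (by omega)
    · rw [Set.inter_comm]; exact volume_fanCone_inter_fanCone hw h (by omega)
  calc ∑ i ∈ range (n - 2), solidAngleFraction 0 ![w 0, w (i + 1), w (i + 2)]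
      = ∑ i ∈ range (n - 2), ballFraction (0 : E3) (fanCone w i) :=
        sum_congr rfl fun i _ => (ballFraction_fanCone w i).symm
    _ = ballFraction (0 : E3) (⋃ i ∈ range (n - 2), fanCone w i) :=
        sum_ballFraction_eq_ballFraction_biUnion _ 0 hmeas hnull
    _ ≤ ballFraction (0 : E3) (polyCone n w) := by
        refine ballFraction_mono 0 (Set.iUnion₂_subset fun i hi => ?_)
        exact fanCone_subset_polyCone hn hw (by have := mem_range.1 hi; omega)

/-- The same with the excess of each fan triangle written through its three angles (Girard):
`Σ_{i<n−2} (∠ + ∠ + ∠ − π) ≤ 4π · ballFraction 0 (polyCone n w)`. [folklore] -/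
theorem sum_fan_angles_sub_pi_le (hn : 3 ≤ n)
    (hw : ∀ i j k, i < j → j < k → k < n → 0 < orient3 (w i) (w j) (w k)) :
    ∑ i ∈ range (n - 2),
        (InnerProductGeometry.angle (perpTo (w 0) (w (i + 1))) (perpTo (w 0) (w (i + 2))) +
          InnerProductGeometry.angle (perpTo (w (i + 1)) (w 0)) (perpTo (w (i + 1)) (w (i + 2))) +
          InnerProductGeometry.angle (perpTo (w (i + 2)) (w 0)) (perpTo (w (i + 2)) (w (i + 1))) -
          π) ≤
      4 * π * ballFraction (0 : E3) (polyCone n w) := by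
  have h := sum_solidAngleFraction_fan_le hn hw
  have hπ : 0 < π := Real.pi_pos
  have hg : ∀ i ∈ range (n - 2), solidAngleFraction 0 ![w 0, w (i + 1), w (i + 2)] =
      (InnerProductGeometry.angle (perpTo (w 0) (w (i + 1))) (perpTo (w 0) (w (i + 2))) +
        InnerProductGeometry.angle (perpTo (w (i + 1)) (w 0)) (perpTo (w (i + 1)) (w (i + 2))) +
        InnerProductGeometry.angle (perpTo (w (i + 2)) (w 0)) (perpTo (w (i + 2)) (w (i + 1))) -
        π) / (4 * π) := by
    intro i hi
    have hli : LinearIndependent ℝ ![w 0, w (i + 1), w (i + 2)] :=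
      linearIndependent_of_orient3_ne_zero
        (hw 0 (i + 1) (i + 2) (by omega) (by omega) (by have := mem_range.1 hi; omega)).ne'
    rw [solidAngleFraction_eq_girard 0 _ hli]
    simp
  rw [sum_congr rfl hg, ← sum_div, div_le_iff₀ (by positivity)] at h
  linarith

end Fan

end Literature.Geometry.DiscreteGeometry

end
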